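import Summits.RiemannHypothesis.RiemannHypothesis.Theorems.SignConeConeMagnificationStubDeficitOfDesign

/-!
# The quantitative deficit bound `Σ_p (log p − c(p))₊/√p ≤ 2M` from design data
(supports item stmt-RiemannHypothesis-16303, route route-RiemannHypothesis-SignCone, crux `SignCone.ConeMagnification`)

`Design.deficit_partial_le` (file `SignConeConeMagnificationStubDeficitOfDesign.lean`) bounds the partial sums
`Σ_{p ≤ z} (log p − c(p))₊/√p ≤ 2M + 4·Σ_{k>z} |d(k)|/k + (C_τ/τ_{z+1})·Σ_n compMassTerm c n` for every `z ≥ 2`, and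
`Design.deficit_summable` records the summability of the deficit series.  The registered stub `stub_deficitOfDesign`
only exports summability.  Here we let `z → ∞`: the tail `Σ_{k>z} |d(k)|/k` of a convergent series tends to `0`
and `τ_{z+1} = (√(z+1) − 1)/2 → ∞`, so the full sum is at most `2M` (2001 W-MAG Thm 1.2(i) with its constant;
Theorem "Magnification" of the sign-cone paper, displayed bound, case of general slack `M` on the design side and
`M = 1` at the stub interface).  This is the declaration the paper cites for the displayed constant `2 = 2M`.

Written 2026-08-17 by the W-MAG paper seat (unit pub-signcone-2) in answer to referee point G2 of
`run/shared/lean/pub/pub-signcone/REFEREE.md`; no new axioms, no sorry.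
-/

noncomputable section

-- `Summit.RiemannHypothesis.RiemannHypothesis.…` repeats a namespace component by design (D-0017 layout).
set_option linter.dupNamespace false

open Finset Filter Topology

namespace Summit.RiemannHypothesis.RiemannHypothesis.Theorems.SignConeConeMagnification

namespace Design

section TsumBound

variable {M : ℝ} {c : ℕ → ℝ}

/-- The `ite`-tail `Σ_k 𝟙_{k ≥ w}·f(k)` of a summable sequence is the shifted sum `Σ_i f(i + w)`. [folklore] -/
theorem tsum_ite_le_eq_tsum_add {f : ℕ → ℝ} (hf : Summable f) (w : ℕ) :
    (∑' k : ℕ, if w ≤ k then f k else 0) = ∑' i : ℕ, f (i + w) := by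
  have hsplit : ∀ k : ℕ, f k = (if w ≤ k then f k else 0) + (if w ≤ k then 0 else f k) := by
    intro k
    split <;> simp
  have hfin : ∀ k ∉ Finset.range w, (if w ≤ k then (0 : ℝ) else f k) = 0 := by
    intro k hk
    rw [Finset.mem_range, not_lt] at hk
    rw [if_pos hk]
  have hs2 : Summable fun k : ℕ => if w ≤ k then (0 : ℝ) else f k :=
    summable_of_ne_finset_zero hfin
  have hs1 : Summable fun k : ℕ => if w ≤ k then f k else 0 := by
    have : (fun k : ℕ => if w ≤ k then f k else 0)
        = fun k => f k - (if w ≤ k then (0 : ℝ) else f k) := by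
      funext k
      split <;> simp
    rw [this]
    exact hf.sub hs2
  have htot : ∑' k : ℕ, f k
      = (∑' k : ℕ, if w ≤ k then f k else 0) + ∑' k : ℕ, (if w ≤ k then (0 : ℝ) else f k) := by
    rw [← hs1.tsum_add hs2]
    exact tsum_congr hsplit
  have hfinsum : (∑' k : ℕ, if w ≤ k then (0 : ℝ) else f k) = ∑ k ∈ Finset.range w, f k := by
    rw [tsum_eq_sum hfin]
    refine Finset.sum_congr rfl fun k hk => ?_
    rw [Finset.mem_range] at hk
    rw [if_neg (by omega)]
  have hshift := hf.sum_add_tsum_nat_add w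
  linarith

/-- The tails `Σ_{k > z} |d(k)|/k` tend to `0` under AX-A. [folklore] -/
theorem tendsto_tail_zero (hd : Summable fun n : ℕ => |dwt c n| / (n : ℝ)) :
    Tendsto (fun z : ℕ => ∑' k : ℕ, if z + 1 ≤ k then |dwt c k| / (k : ℝ) else 0) atTop (𝓝 0) := by
  have h := (tendsto_sum_nat_add fun n : ℕ => |dwt c n| / (n : ℝ)).comp (tendsto_add_atTop_nat 1)
  refine h.congr fun z => ?_
  simp only [Function.comp]
  exact (tsum_ite_le_eq_tsum_add hd (z + 1)).symm

/-- `τ_{z+1} = (√(z+1) − 1)/2 → ∞`. [folklore] -/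
theorem tendsto_tauP_succ_atTop : Tendsto (fun z : ℕ => tauP (z + 1)) atTop atTop := by
  have h1 : Tendsto (fun z : ℕ => ((z + 1 : ℕ) : ℝ)) atTop atTop :=
    tendsto_natCast_atTop_atTop.comp (tendsto_add_atTop_nat 1)
  have h2 : Tendsto (fun z : ℕ => Real.sqrt ((z + 1 : ℕ) : ℝ)) atTop atTop :=
    Real.tendsto_sqrt_atTop.comp h1
  have h3 : Tendsto (fun z : ℕ => Real.sqrt ((z + 1 : ℕ) : ℝ) - 1) atTop atTop :=
    tendsto_atTop_add_const_right _ (-1) h2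
  have h4 := h3.atTop_div_const (r := (2 : ℝ)) (by norm_num)
  refine h4.congr fun z => ?_
  simp [tauP]

/-- `C_τ/τ_{z+1} → 0`. [folklore] -/
theorem tendsto_cTau_div_tauP_zero : Tendsto (fun z : ℕ => cTau / tauP (z + 1)) atTop (𝓝 0) :=
  tendsto_const_nhds.div_atTop tendsto_tauP_succ_atTop

/-- **2001 W-MAG Thm 1.2(i) with its constant**: under the design data at slack `M` (AX-A, AX-B, AX-C with right
side `M/2`), `Σ_p (log p − c(p))₊/√p ≤ 2M` — let `z → ∞` in `Design.deficit_partial_le`. [folklore] -/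
theorem deficit_tsum_le (hc : ∀ n, 0 ≤ c n) (hc1 : c 1 = 0)
    (hd : Summable fun n : ℕ => |dwt c n| / (n : ℝ)) (hB : Summable (compMassTerm c))
    (hC : ∀ S : Finset ℕ, (∀ p ∈ S, p.Prime) → ∀ a : ℕ → ℝ,
      (∀ p ∈ S, 0 ≤ a p ∧ a p ≤ 1) → ∀ φ : ℝ,
      (∑' n : ℕ, dwt c n / (n : ℝ) * profile S a φ n) ≤ M / 2) :
    ∑' p : ℕ, deficitTerm c p ≤ 2 * M := by
  have hdef := deficit_summable hc hc1 hd hB hC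
  -- partial sums over `range (z+1)` converge to the `tsum`
  have hS : Tendsto (fun z : ℕ => ∑ n ∈ Finset.range (z + 1), deficitTerm c n) atTop
      (𝓝 (∑' p : ℕ, deficitTerm c p)) :=
    hdef.tendsto_sum_tsum_nat.comp (tendsto_add_atTop_nat 1)
  -- the right side of `deficit_partial_le` converges to `2M`
  set B : ℝ := ∑' n : ℕ, compMassTerm c n with hBdef
  have hR : Tendsto (fun z : ℕ => 2 * M
      + 4 * (∑' k : ℕ, if z + 1 ≤ k then |dwt c k| / (k : ℝ) else 0)
      + cTau / tauP (z + 1) * B) atTop (𝓝 (2 * M)) := by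
    have h := (tendsto_const_nhds (x := 2 * M)).add
      (((tendsto_tail_zero hd).const_mul 4).add ((tendsto_cTau_div_tauP_zero).mul_const B))
    have h0 : 2 * M + (4 * 0 + 0 * B) = 2 * M := by ring
    rw [h0] at h
    refine h.congr fun z => ?_
    ring
  refine le_of_tendsto_of_tendsto hS hR ?_
  rw [EventuallyLE, eventually_atTop]
  refine ⟨2, fun z hz => ?_⟩
  rw [sum_range_deficitTerm c z]
  exact deficit_partial_le hc hc1 hd hB hC hz

end TsumBound

end Design

/-! ### At the stub interface (`M = 1`, hypotheses unfolded as in `stub_deficitOfDesign`) -/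

open Design in
/-- **The displayed constant of the magnification theorem at `M = 1`**: design data (AX-A), (AX-B), (AX-C) for a weight
`c ≥ 0` with `c 1 = 0` give `Σ_p (log p − c(p))₊/√p ≤ 2`; same hypotheses as `stub_deficitOfDesign`. [folklore] -/
theorem deficitOfDesign_tsum_le_two :
    ∀ c : ℕ → ℝ, (∀ n, 0 ≤ c n) → c 1 = 0 →
      Summable (fun n : ℕ => |c n - ArithmeticFunction.vonMangoldt n| / (n : ℝ)) →
      Summable (fun n : ℕ => if 2 ≤ n ∧ ¬ IsPrimePow n then
        c n / (n : ℝ) * (∑ q ∈ n.primeFactors, ∑ q' ∈ n.primeFactors.filter (fun q' => q < q'),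
          ((Real.sqrt q - 1) / 2) * ((Real.sqrt q' - 1) / 2)) else 0) →
      (∀ S : Finset ℕ, (∀ p ∈ S, p.Prime) → ∀ a : ℕ → ℝ, (∀ p ∈ S, 0 ≤ a p ∧ a p ≤ 1) → ∀ φ : ℝ,
        (∑' n : ℕ, (c n - ArithmeticFunction.vonMangoldt n) / (n : ℝ) *
          (if ∀ p ∈ S, ¬ (p ^ 2 ∣ n) then
            Real.sqrt (∏ p ∈ S.filter (· ∣ n), (p : ℝ)) * (∏ p ∈ S.filter (· ∣ n), a p) *
              (1 / 2) ^ (S.filter (· ∣ n)).card * Real.cos (((S.filter (· ∣ n)).card : ℝ) * φ)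
          else 0)) ≤ 1 / 2) →
      (Summable (fun p : ℕ => if p.Prime then max (Real.log p - c p) 0 / Real.sqrt p else 0) ∧
        ∑' p : ℕ, (if p.Prime then max (Real.log p - c p) 0 / Real.sqrt p else 0) ≤ 2) := by
  intro c hc hc1 hA hB hC
  have hd : Summable fun n : ℕ => |dwt c n| / (n : ℝ) := hA
  have hB' : Summable (compMassTerm c) := hB
  have hC' : ∀ S : Finset ℕ, (∀ p ∈ S, p.Prime) → ∀ a : ℕ → ℝ,
      (∀ p ∈ S, 0 ≤ a p ∧ a p ≤ 1) → ∀ φ : ℝ,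
      (∑' n : ℕ, dwt c n / (n : ℝ) * profile S a φ n) ≤ (1 : ℝ) / 2 := hC
  have h1 : Summable (deficitTerm c) := deficit_summable hc hc1 hd hB' hC'
  have h2 : ∑' p : ℕ, deficitTerm c p ≤ 2 * 1 := deficit_tsum_le hc hc1 hd hB' hC'
  refine ⟨h1, ?_⟩
  have h3 : (fun p : ℕ => if p.Prime then max (Real.log p - c p) 0 / Real.sqrt p else 0) = deficitTerm c := rfl
  rw [h3]
  linarith

end Summit.RiemannHypothesis.RiemannHypothesis.Theorems.SignConeConeMagnification

end
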